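import Summits.Ventures.PercRepro2.CaseOnePairPocketMain
import Summits.Ventures.PercRepro2.CaseOnePocketCore

/-!
# All the moves of the lane in one relation: thickenings, pendant steps, pocket steps, pair steps
(blind cell PercRepro2, p1 g27; `CaseOneMoves` / `CaseOnePocketMoves` extended by the general pocket
step and the pair step)

`MoveStepQ` has four kinds of step: a `MoveStep` (the thickenings and the pendant step of
`CaseOneMoves`); the LEAF POCKET step (`closedAt_of_pocket`: from the cut vertex `x` of a mark-free
pocket in the contracted graph to the statement vertex `a₃ ∈ W` in `G`); the POCKET step at a designated
vertex `z` (`closedAt_of_pocket'`: the statement vertex fixed, a pocket containing at most one special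
vertex `z` replaced by the pendant edge `{x, z}`); and the PAIR step (`closedAt_of_pair`: the statement
vertex fixed, a pocket containing two of `o, a₃, b` with the roots outside replaced by its tree gadget).
`MovesQ` is the reflexive–transitive closure; **`closedAt_of_movesQ`**, **`closedAt_of_movesQ_closedAnchor`**,
and the core **`InCoreQ`** with **`closedAt_of_coreQ`**: the four forms on every core instance give them on
every finite graph — `InCoreQ ⊆ InCoreP ⊆ InCore` (`InCoreP.of_inCoreQ`, `InCore.of_inCoreP`). Own code;
standard axioms. -/

namespace Summit.Ventures.PercRepro2

namespace CaseOne

universe u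

section MovesQ
variable {V : Type*}

/-- **One move of the lane**: a `MoveStep`, a leaf-pocket step, a pocket step at a designated vertex,
or a pair step. -/
inductive MoveStepQ (o a₁ a₂ b : V) :
    (E' : Type u) → [Fintype E'] → [DecidableEq E'] → (E' → Sym2 V) → V →
      (E : Type u) → [Fintype E] → [DecidableEq E] → (E → Sym2 V) → V → Prop
  /-- a thickening or a pendant step -/
  | move {E' : Type u} [Fintype E'] [DecidableEq E'] {ends' : E' → Sym2 V} {v' : V} {E : Type u}
      [Fintype E] [DecidableEq E] {ends : E → Sym2 V} {v : V}
      (h : MoveStep o a₁ a₂ b E' ends' v' E ends v) : MoveStepQ o a₁ a₂ b E' ends' v' E ends v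
  /-- the leaf-pocket step: from `x` in the contracted graph to `a₃ ∈ W` in `G` -/
  | pocketLeaf (E : Type u) [Fintype E] [DecidableEq E] (ends : E → Sym2 V) (W : Set V) (x : V)
      (P : Finset E) (e₀ : E) (a₃ : V) (h : IsPocket ends W x P) (he : e₀ ∈ P) (ha : a₃ ∈ W)
      (ho : o ∉ W) (h1 : a₁ ∉ W) (h2 : a₂ ∉ W) (hb : b ∉ W) :
      MoveStepQ o a₁ a₂ b E (pocketEnds ends P e₀ a₃ x) x E ends a₃
  /-- the pocket step at a designated vertex `z`, the statement vertex fixed -/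
  | pocket (E : Type u) [Fintype E] [DecidableEq E] (ends : E → Sym2 V) (W : Set V) (x : V)
      (P : Finset E) (e₀ : E) (z a₃ : V) (h : IsPocket ends W x P) (he : e₀ ∈ P)
      (ho : o ∉ W ∨ o = z) (h1 : a₁ ∉ W ∨ a₁ = z) (h2 : a₂ ∉ W ∨ a₂ = z) (ha : a₃ ∉ W ∨ a₃ = z)
      (hb : b ∉ W ∨ b = z) :
      MoveStepQ o a₁ a₂ b E (pocketEnds ends P e₀ z x) a₃ E ends a₃
  /-- the pair step: two of `o, a₃, b` in a pocket with the roots outside, the statement vertex fixed -/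
  | pair (E : Type u) [Fintype E] [DecidableEq E] (ends : E → Sym2 V) (W : Set V) (x : V)
      (P : Finset E) (e₁ e₂ e₃ : E) (w z₁ z₂ a₃ : V) (hh : IsPairPocket ends W x P e₁ e₂ e₃ w z₁ z₂)
      (h1 : a₁ ∉ W) (h2 : a₂ ∉ W) (ho : o ∉ W ∨ o = z₁ ∨ o = z₂) (ha : a₃ ∉ W ∨ a₃ = z₁ ∨ a₃ = z₂)
      (hb : b ∉ W ∨ b = z₁ ∨ b = z₂) :
      MoveStepQ o a₁ a₂ b E (pairEnds ends P e₁ e₂ e₃ x w z₁ z₂) a₃ E ends a₃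

/-- **The moves of the lane**: finitely many `MoveStepQ`s. -/
inductive MovesQ (o a₁ a₂ b : V) :
    (E' : Type u) → [Fintype E'] → [DecidableEq E'] → (E' → Sym2 V) → V →
      (E : Type u) → [Fintype E] → [DecidableEq E] → (E → Sym2 V) → V → Prop
  /-- no move -/
  | refl (E : Type u) [Fintype E] [DecidableEq E] (ends : E → Sym2 V) (v : V) :
      MovesQ o a₁ a₂ b E ends v E ends v
  /-- one more move -/
  | tail {E' : Type u} [Fintype E'] [DecidableEq E'] {ends' : E' → Sym2 V} {v' : V} {Em : Type u}
      [Fintype Em] [DecidableEq Em] {endsm : Em → Sym2 V} {vm : V} {E : Type u} [Fintype E]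
      [DecidableEq E] {ends : E → Sym2 V} {v : V} (h : MovesQ o a₁ a₂ b E' ends' v' Em endsm vm)
      (hstep : MoveStepQ o a₁ a₂ b Em endsm vm E ends v) : MovesQ o a₁ a₂ b E' ends' v' E ends v

variable {R : Type*} [Field R] [LinearOrder R] [IsStrictOrderedRing R] {o a₁ a₂ b : V}

/-- One move of the lane preserves the closed property. -/
theorem closedAt_of_moveStepQ {E' : Type u} [Fintype E'] [DecidableEq E'] {ends' : E' → Sym2 V}
    {v' : V} {E : Type u} [Fintype E] [DecidableEq E] {ends : E → Sym2 V} {v : V}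
    (h : MoveStepQ o a₁ a₂ b E' ends' v' E ends v) (hc : ClosedAt R o a₁ a₂ b E' ends' v') :
    ClosedAt R o a₁ a₂ b E ends v := by
  cases h with
  | move h => exact closedAt_of_moveStep h hc
  | pocketLeaf =>
    exact closedAt_of_pocket (by assumption) (by assumption) (by assumption) (by assumption)
      (by assumption) (by assumption) (by assumption) hc
  | pocket =>
    exact closedAt_of_pocket' (by assumption) (by assumption) (by assumption) (by assumption)
      (by assumption) (by assumption) (by assumption) hc
  | pair =>
    exact closedAt_of_pair (by assumption) (by assumption) (by assumption) (by assumption)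
      (by assumption) (by assumption) hc

/-- **The closed property is preserved by every sequence of moves of the lane.** -/
theorem closedAt_of_movesQ {E' : Type u} [Fintype E'] [DecidableEq E'] {ends' : E' → Sym2 V}
    {v' : V} {E : Type u} [Fintype E] [DecidableEq E] {ends : E → Sym2 V} {v : V}
    (h : MovesQ o a₁ a₂ b E' ends' v' E ends v) (hc : ClosedAt R o a₁ a₂ b E' ends' v') :
    ClosedAt R o a₁ a₂ b E ends v := by
  induction h with
  | refl => exact hc
  | tail _ hstep ih => exact closedAt_of_moveStepQ hstep ih

/-- Every sequence of moves with pockets is a sequence of moves of the lane. -/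
theorem MovesQ.of_movesP {E' : Type u} [Fintype E'] [DecidableEq E'] {ends' : E' → Sym2 V} {v' : V}
    {E : Type u} [Fintype E] [DecidableEq E] {ends : E → Sym2 V} {v : V}
    (h : MovesP o a₁ a₂ b E' ends' v' E ends v) : MovesQ o a₁ a₂ b E' ends' v' E ends v := by
  induction h with
  | refl => exact MovesQ.refl _ _ _
  | tail _ hstep ih =>
    refine MovesQ.tail ih ?_
    cases hstep with
    | move h => exact MoveStepQ.move h
    | pocket =>
      exact MoveStepQ.pocketLeaf _ _ _ _ _ _ _ (by assumption) (by assumption) (by assumption)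
        (by assumption) (by assumption) (by assumption) (by assumption)

end MovesQ

section CoreQ
variable {V : Type*} [Fintype V] [DecidableEq V] (o a₁ a₂ b v : V)

/-- **Every instance reachable by moves of the lane from a closed anchor is closed.** -/
theorem closedAt_of_movesQ_closedAnchor {R : Type*} [Field R] [LinearOrder R] [IsStrictOrderedRing R]
    {E' : Type u} [Fintype E'] [DecidableEq E'] {ends' : E' → Sym2 V} {v' : V}
    (h' : ClosedAnchor o a₁ a₂ b E' ends' v') {E : Type u} [Fintype E] [DecidableEq E]
    {ends : E → Sym2 V} {v : V} (h : MovesQ o a₁ a₂ b E' ends' v' E ends v) :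
    ClosedAt R o a₁ a₂ b E ends v :=
  closedAt_of_movesQ h (closedAt_of_closedAnchor o a₁ a₂ b E' ends' v' h')

/-- **The core of the lane**: residual for `v`, and not reachable by moves of the lane from a closed
anchor. -/
def InCoreQ (E : Type u) [Fintype E] [DecidableEq E] (ends : E → Sym2 V) : Prop :=
  Residual o a₁ a₂ b v E ends ∧
    ¬ ∃ (E₀ : Type u) (_ : Fintype E₀) (_ : DecidableEq E₀) (ends₀ : E₀ → Sym2 V) (v₀ : V),
      ClosedAnchor o a₁ a₂ b E₀ ends₀ v₀ ∧ MovesQ o a₁ a₂ b E₀ ends₀ v₀ E ends v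

omit [Fintype V] [DecidableEq V] in
/-- The core of the lane is contained in the core with pockets. -/
theorem InCoreP.of_inCoreQ (E : Type u) [Fintype E] [DecidableEq E] (ends : E → Sym2 V)
    (h : InCoreQ o a₁ a₂ b v E ends) : InCoreP o a₁ a₂ b v E ends := by
  refine ⟨h.1, fun hreach => h.2 ?_⟩
  obtain ⟨E₀, _, _, ends₀, v₀, hanc, hmv⟩ := hreach
  exact ⟨E₀, inferInstance, inferInstance, ends₀, v₀, hanc, MovesQ.of_movesP hmv⟩

variable {R : Type*} [Field R] [LinearOrder R] [IsStrictOrderedRing R]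

/-- **The reduction to the core of the lane**: the four forms for every weight vector on every core
instance give them on every finite graph. -/
theorem closedAt_of_coreQ
    (hcore : ∀ (E' : Type u) [Fintype E'] [DecidableEq E'] (ends' : E' → Sym2 V),
      InCoreQ o a₁ a₂ b v E' ends' → ClosedAt R o a₁ a₂ b E' ends' v)
    (E : Type u) [Fintype E] [DecidableEq E] (ends : E → Sym2 V) : ClosedAt R o a₁ a₂ b E ends v := by
  refine closedAt_of_residual (fun E' _ _ ends' hres => ?_) E ends
  by_cases hreach : ∃ (E₀ : Type u) (_ : Fintype E₀) (_ : DecidableEq E₀) (ends₀ : E₀ → Sym2 V)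
      (v₀ : V), ClosedAnchor o a₁ a₂ b E₀ ends₀ v₀ ∧ MovesQ o a₁ a₂ b E₀ ends₀ v₀ E' ends' v
  · obtain ⟨E₀, _, _, ends₀, v₀, hanc, hmv⟩ := hreach
    exact closedAt_of_movesQ_closedAnchor o a₁ a₂ b hanc hmv
  · exact hcore E' ends' ⟨hres, hreach⟩

end CoreQ

end CaseOne

end Summit.Ventures.PercRepro2
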